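import Mathlib
import Summits.MatrixMultiplication.Statement
import Summits.MatrixMultiplication.MatrixMultiplication.Theorems.GraphEquationsCubicBase
import Summits.MatrixMultiplication.MatrixMultiplication.Theorems.GraphEquationsDerivations
import Summits.MatrixMultiplication.MatrixMultiplication.Theorems.GraphEquationsCubicNormalForm

/-!
# GraphEquations — the cubic dictionary: `AQRₙ ⟹ C3ₙ` for `n ≥ 3` (M43; cell `decomp-mm`, lens-5 g40)

Helper kernel beneath the attacked crux `MultiplicityReduction` (stmt-MatrixMultiplication-27806) of
route `GraphEquations`, rung `K = 3` of the degree ladder (`GraphEquationsCubicRung.CubicReduction`).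

**The dictionary, as a theorem.**  For `n ≥ 3`, affine–quadric rigidity (`AffSystem.AffineQuadricRigidity n`
of `GraphEquationsAffineQuadric`: every correct finite affine system `⟨κ + L_A A + L_B B + M C, C − AB⟩` is
reduced at some point) IMPLIES `CubicReduction n` (every correct cubic equation system for the graph `W_n` is
generically reduced): `cubicReduction_of_affineQuadricRigidity`.  Proof: by the cubic normal form
(`GraphEquationsCubicNormalForm.exists_affTest_of_cubic`) every test of a correct cubic system IS an affine
test as a function (`affSystemOf`), the affine system is correct because the zero sets agree
(`affSystemOf_correct`), a polynomial is determined by its values so the test equals the affine test's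
polynomial `Σ_q g_q · f_q` (`AffTest.poly`, `testPoly_eq_poly`), whence its `C`-gradient on the graph is the
affine test's gradient `g(A,B,AB)` (`AffTest.eval_pderiv_poly`, with
`GraphEquationsDerivations.pderiv_inr_generator_eq_ite`), and full rank of the gradients
(`AffSystem.ReducedAt`) is full rank `n²` of the `C`-Jacobian (`reducedAt_of_affReducedAt`).

**The lens triple as one theorem** (`omega_le_of_affineQuadricRigidity`): BASE RANGE `C3₀, C3₁`
(`GraphEquationsCubicBase`, proved) + FINITE CHECK `C3₂` (hypothesis; instrumentable) + ASYMPTOTIC REGIME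
`∀ n ≥ 3, AQRₙ` (hypothesis; the open conjecture, now on finite-dimensional data `(κ, L_A, L_B, M)`) ⟹
`∀ n, C3ₙ` (`cubicReduction_all`) ⟹ BRIDGE `omega_le_of_eqAdmissibleCubic` (M35) ⟹ `ω ≤ β` for every cubic
admissible exponent `β ≥ 2`.  Sorry-free; no stub credit claimed.
-/

set_option linter.dupNamespace false
set_option linter.unusedSectionVars false

noncomputable section

namespace Summit.MatrixMultiplication.MatrixMultiplication.Theorems.GraphEquations

open MvPolynomial Matrix Literature.Computability.AlgebraicComplexity

variable {n : ℕ}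

/-! ## The polynomial of an affine test and its `C`-gradient -/

namespace AffTest

variable (g : AffTest n)

/-- The `q`-th coefficient `g_q = κ_q + Σ_v (L_A)_{qv} a_v + Σ_w (L_B)_{qw} b_w + Σ_{q'} M_{qq'} c_{q'}` as a
polynomial. -/
def coefPoly (q : Fin n × Fin n) : MvPolynomial (GraphVars n) ℂ :=
  C (g.κ q) + ∑ v, C (g.LA q v) * X (aVar v) + ∑ w, C (g.LB q w) * X (bVar w)
    + ∑ q', C (g.M q q') * X (cVar q')

/-- The affine test as a polynomial: `Σ_q g_q · f_q` with `f_q = c_q − (AB)_q` the generators. -/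
def poly : MvPolynomial (GraphVars n) ℂ := ∑ q, g.coefPoly q * generator n q

/-- Value of the coefficient polynomial. -/
theorem eval_pt_coefPoly (q : Fin n × Fin n) (A B C : Vec n) :
    MvPolynomial.eval (pt A B C) (g.coefPoly q) = g.coef A B C q := by
  simp [coefPoly, AffTest.coef, mulVec, dotProduct, map_sum, pt, aVar, bVar, cVar]

/-- Value of a generator: `f_q(A,B,C) = c_q − (AB)_q`. -/
theorem eval_pt_generator (q : Fin n × Fin n) (A B C : Vec n) :
    MvPolynomial.eval (pt A B C) (generator n q) = C q - prodVec A B q := by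
  simp [generator, pt, prodVec, prodEntry, map_sum]

/-- The polynomial evaluates to the affine test. -/
theorem eval_pt_poly (A B C : Vec n) : MvPolynomial.eval (pt A B C) g.poly = g.eval A B C := by
  simp only [poly, map_sum, map_mul, eval_pt_coefPoly, eval_pt_generator, AffTest.eval, dotProduct,
    Pi.sub_apply]

/-- **The `C`-gradient of an affine test on the graph is `g(A,B,AB)`:**
`(∂/∂c_q Σ_{q'} g_{q'} f_{q'})(A,B,AB) = g_q(A,B,AB)` (the `f_{q'}` vanish there). -/
theorem eval_pderiv_poly (q : Fin n × Fin n) (A B : Vec n) :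
    MvPolynomial.eval (pt A B (prodVec A B)) (pderiv (Sum.inr q) g.poly) = g.jac A B q := by
  classical
  simp only [poly, map_sum, Derivation.leibniz, smul_eq_mul, map_add, map_mul, eval_pt_generator,
    sub_self, pderiv_inr_generator_eq_ite, eval_pt_coefPoly]
  simp only [apply_ite (MvPolynomial.eval (pt A B (prodVec A B))), map_one, map_zero, mul_ite, mul_one,
    mul_zero, zero_mul, add_zero, Finset.sum_ite_eq', Finset.mem_univ, if_true, jac]

end AffTest

/-- A polynomial agreeing with an affine test as a function IS the affine test's polynomial. -/
theorem eq_poly_of_eval_eq {t : MvPolynomial (GraphVars n) ℂ} {g : AffTest n}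
    (h : ∀ A B C : Vec n, eval (pt A B C) t = g.eval A B C) : t = g.poly := by
  apply MvPolynomial.funext
  intro x
  rw [← pt_eta x, h, AffTest.eval_pt_poly]

/-! ## From a correct cubic system to a correct affine system -/

namespace EqSystem

variable {E : EqSystem n}

/-- The tests of a correct system vanish on the graph (indexed form). -/
theorem Correct.eval_test_eq_zero (hE : E.Correct) (o : Fin E.tests.length) {x : GraphVars n → ℂ}
    (hx : x ∈ mmGraph n) : eval x (E.testPoly (E.tests.get o)) = 0 :=
  hE.eval_testPoly_eq_zero hx (List.get_mem _ _)

end EqSystem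

section Dictionary

variable (hn : 3 ≤ n) {E : EqSystem n} (hE : E.Correct) (hc : E.IsCubic)
include hn hE hc

/-- Normal forms of the tests of a correct cubic system (`n ≥ 3`). -/
theorem exists_affTests : ∃ g : Fin E.tests.length → AffTest n,
    ∀ o A B C, eval (pt A B C) (E.testPoly (E.tests.get o)) = (g o).eval A B C := by
  choose g hg using fun o : Fin E.tests.length =>
    exists_affTest_of_cubic hn (hc o) (fun x hx => hE.eval_test_eq_zero o hx)
  exact ⟨g, hg⟩

end Dictionary

/-- The affine system of a family of affine tests. -/
def affSystemOf {m : ℕ} (g : Fin m → AffTest n) : AffSystem n := ⟨m, g⟩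

/-- If the tests of `E` are the affine tests `g` (as functions) and `E` is correct, the affine system is
correct. -/
theorem affSystemOf_correct {E : EqSystem n} (hE : E.Correct) {g : Fin E.tests.length → AffTest n}
    (hg : ∀ o A B C, eval (pt A B C) (E.testPoly (E.tests.get o)) = (g o).eval A B C) :
    (affSystemOf g).Correct := by
  intro A B C h
  have hx : pt A B C ∈ E.zeroSet := by
    intro j hj
    obtain ⟨o, ho⟩ := List.mem_iff_get.1 hj
    rw [← ho, hg o]
    exact h o
  rw [hE.2] at hx
  exact (pt_mem_mmGraph_iff A B C).1 hx

/-- If the tests of `E` are the affine tests `g` (as functions), the `C`-Jacobian of `E` at `(A,B,AB)` is the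
matrix of gradients `g_o(A,B,AB)`. -/
theorem jacobianC_eq_of_affTests {E : EqSystem n} {g : Fin E.tests.length → AffTest n}
    (hg : ∀ o A B C, eval (pt A B C) (E.testPoly (E.tests.get o)) = (g o).eval A B C) (A B : Vec n) :
    E.jacobianC (pt A B (prodVec A B)) = Matrix.of fun o q => (g o).jac A B q := by
  ext o q
  rw [EqSystem.jacobianC, Matrix.of_apply, Matrix.of_apply, eq_poly_of_eval_eq (hg o)]
  exact (g o).eval_pderiv_poly q A B

/-- Full rank of the gradients (affine reducedness) is full rank `n²` of the `C`-Jacobian. -/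
theorem reducedAt_of_affReducedAt {E : EqSystem n} {g : Fin E.tests.length → AffTest n}
    (hg : ∀ o A B C, eval (pt A B C) (E.testPoly (E.tests.get o)) = (g o).eval A B C) {A B : Vec n}
    (hred : (affSystemOf g).ReducedAt A B) : E.ReducedAt (pt A B (prodVec A B)) := by
  classical
  rw [EqSystem.ReducedAt, jacobianC_eq_of_affTests hg, Matrix.rank]
  set J : Matrix (Fin E.tests.length) (Fin n × Fin n) ℂ := Matrix.of fun o q => (g o).jac A B q with hJ
  have hker : LinearMap.ker J.mulVecLin = ⊥ := by
    rw [LinearMap.ker_eq_bot']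
    intro δ hδ
    apply hred δ
    intro o
    have h : J.mulVecLin δ o = 0 := by rw [hδ]; rfl
    simpa [J, mulVec, dotProduct, affSystemOf] using h
  have h := LinearMap.finrank_range_add_finrank_ker J.mulVecLin
  rw [hker, finrank_bot, add_zero, Module.finrank_fintype_fun_eq_card, Fintype.card_prod, Fintype.card_fin]
    at h
  exact h

/-- **The dictionary (`n ≥ 3`): affine–quadric rigidity implies cubic reduction.** -/
theorem cubicReduction_of_affineQuadricRigidity (hn : 3 ≤ n) (hA : AffSystem.AffineQuadricRigidity n) :
    CubicReduction n := by
  intro E hE hc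
  obtain ⟨g, hg⟩ := exists_affTests hn hE hc
  obtain ⟨A, B, hred⟩ := hA (affSystemOf g) (affSystemOf_correct hE hg)
  exact ⟨pt A B (prodVec A B), pt_prodVec_mem A B, reducedAt_of_affReducedAt hg hred⟩

/-! ## The lens triple: base range + finite check + asymptotic regime ⟹ the bridge fires -/

/-- `C3ₙ` for all `n` from: the base range `n ≤ 1` (proved), the finite check `C3₂` (hypothesis) and
affine–quadric rigidity for `n ≥ 3` (hypothesis). -/
theorem cubicReduction_all (h2 : CubicReduction 2)
    (hA : ∀ n, 3 ≤ n → AffSystem.AffineQuadricRigidity n) : ∀ n, CubicReduction n := by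
  intro n
  rcases Nat.lt_or_ge n 2 with hn | hn
  · exact cubicReduction_of_le_one (by omega)
  · rcases Nat.lt_or_ge n 3 with hn3 | hn3
    · obtain rfl : n = 2 := by omega
      exact h2
    · exact cubicReduction_of_affineQuadricRigidity hn3 (hA n hn3)

/-- Under `C3₂` and `AQRₙ (n ≥ 3)`, cubic admissibility is reduced admissibility (the route's currency). -/
theorem eqAdmissibleRed_of_affineQuadricRigidity (h2 : CubicReduction 2)
    (hA : ∀ n, 3 ≤ n → AffSystem.AffineQuadricRigidity n) {β : ℝ} (h : EqAdmissibleCubic β) :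
    EqAdmissibleRed β :=
  eqAdmissibleRed_of_eqAdmissibleCubic (cubicReduction_all h2 hA) h

/-- **Base + finite + asymptotic ⟹ bridge:** under `C3₂` and `AQRₙ (n ≥ 3)`, every cubic admissible exponent
`β ≥ 2` bounds `ω`. -/
theorem omega_le_of_affineQuadricRigidity (h2 : CubicReduction 2)
    (hA : ∀ n, 3 ≤ n → AffSystem.AffineQuadricRigidity n) {β : ℝ} (hβ : 2 ≤ β)
    (h : EqAdmissibleCubic β) : omega ℂ ≤ β :=
  omega_le_of_eqAdmissibleCubic (cubicReduction_all h2 hA) hβ h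

end Summit.MatrixMultiplication.MatrixMultiplication.Theorems.GraphEquations

end
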